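import Summits.AnomalousDissipation.AnomalousDissipation.Theses.MomentParity
import Literature.Analysis.FluidPDE.StatisticalSolutionEnergyEq

/-!
# Negative knowledge for the crux `MomentParity.CubicParityLoud` (stmt-AnomalousDissipation-11465), I:
# clauses, the Bernstein ceiling, concrete forces

Certified copy of §0, §1 and §3 of the cdisprove work file `Cruxes/CubicParityLoud/Disproof.lean`
(refuter-cdisprove-stmt-AnomalousDissipation-11465-0, cycle 1). Supports stmt-AnomalousDissipation-11465;
nothing here closes an item (no conclusion asserts a Theses decl).

* §0 names the clauses of the crux (`IsLevel`, `IsBandTest`, `polyGrad`, `IsStationary3`, `IsWitness`) and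
  unfolds the crux through them (`cubicParityLoud_iff`, `Iff.rfl`).
* §1 BERNSTEIN CEILING: a law carried by level-`N` fields with integrable energy has
  `ensembleDissipation ν μ ≤ 4π²N²ν · ensembleEnergy μ` (no stationarity used).
* §3 the four concrete forces used by the negative lemmas: zero, constant wind `e₁` (div-free, not
  mean-zero), gradient mode `cos(2πx₁)e₁` (mean-zero, not div-free, does no work on `H`), shear mode
  `cos(2πx₁)e₂` (admissible and non-zero).
-/

noncomputable section

namespace Summit.AnomalousDissipation.AnomalousDissipation.Theorems.CubicParityLoud.Negative

open MeasureTheory Filter UnitAddTorus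
open scoped InnerProductSpace RealInnerProductSpace ENNReal
open Literature.Analysis.FunctionSpaces Literature.Analysis.FluidPDE
open Summit.AnomalousDissipation.AnomalousDissipation.Theses.MomentParity

/-- The 3-torus. -/
abbrev T3 : Type := UnitAddTorus (Fin 3)
/-- Velocity values. -/
abbrev R3 : Type := EuclideanSpace ℝ (Fin 3)
/-- The energy space `H = L²_σ(T3)` of the crux. -/
abbrev H3 : Type := ↥(Torus.energySpace (Fin 3))
/-- `L²(T3; ℝ³)`. -/
abbrev L2T3 : Type := ↥(Lp (EuclideanSpace ℝ (Fin 3)) 2 (volume : Measure (UnitAddTorus (Fin 3))))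

/-! ## §0 Vocabulary: the clauses of the crux, named (verbatim sub-terms of `CubicParityLoud`) -/

/-- `u ∈ H` is carried by the level-`N` Fourier–Galerkin space: `û(k) = 0` off `0 < |k|² ≤ N²`. -/
def IsLevel (N : ℕ) (u : H3) : Prop :=
  ∀ k ∉ (Torus.freqBall N).erase (0 : Fin 3 → ℤ),
    mFourierCoeff (EuclideanSpace.complexify ∘ (u.1 : T3 → R3)) k = 0

/-- Band-limited smooth solenoidal mean-zero test field (the `g i` of the crux). -/
def IsBandTest (N : ℕ) (g : T3 → R3) : Prop :=
  Torus.IsSmooth g ∧ Torus.IsDivFree g ∧ Torus.HasZeroMean g ∧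
    ∀ k ∉ (Torus.freqBall N).erase (0 : Fin 3 → ℤ), mFourierCoeff (EuclideanSpace.complexify ∘ g) k = 0

/-- The differential `∇p(u) = Σᵢ ∂ᵢP((u,g₁),…,(u,gₘ)) gᵢ` of a polynomial cylindrical observable. -/
def polyGrad {m : ℕ} (g : Fin m → T3 → R3) (P : MvPolynomial (Fin m) ℝ) (u : H3) : T3 → R3 :=
  fun x => ∑ i : Fin m,
    (MvPolynomial.eval (fun j => Torus.pairing u.1 (g j)) (MvPolynomial.pderiv i P)) • g i x

/-- The 3-stationarity rows of the crux at `(ν, f, N)`: every polynomial cylindrical observable of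
total degree `≤ 2` with level-`N` test fields is drift-free (integrable row, zero mean). -/
def IsStationary3 (ν : ℝ) (f : T3 → R3) (N : ℕ) (μ : Measure H3) : Prop :=
  ∀ (m : ℕ) (g : Fin m → T3 → R3) (P : MvPolynomial (Fin m) ℝ), (∀ i, IsBandTest N (g i)) →
    P.totalDegree + 1 ≤ 3 →
      Integrable (fun u => Torus.nsGeneratorPairing ν f u (polyGrad g P u)) μ ∧
        ∫ u, Torus.nsGeneratorPairing ν f u (polyGrad g P u) ∂μ = 0

/-- All clauses the crux asks of the measure `μ` at `(f, ν, N, E, ε)`. -/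
def IsWitness (f : T3 → R3) (ν : ℝ) (N : ℕ) (E ε : ℝ) (μ : Measure H3) : Prop :=
  IsProbabilityMeasure μ ∧ (∀ᵐ u ∂μ, IsLevel N u) ∧ Integrable (fun u : H3 => ‖u‖ ^ 3) μ ∧
    IsStationary3 ν f N μ ∧ Torus.ensembleEnergy μ ≤ E ∧ ε ≤ Torus.ensembleDissipation ν μ

/-- The crux, clause-named (definitional unfolding, `Iff.rfl`). -/
theorem cubicParityLoud_iff :
    CubicParityLoud ↔
      ∀ f : T3 → R3, Torus.IsSmooth f → Torus.IsDivFree f → Torus.HasZeroMean f → f ≠ 0 →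
        ∃ E ε ν₀ : ℝ, 0 < ε ∧ 0 < ν₀ ∧ ∀ ν : ℝ, 0 < ν → ν < ν₀ → ∃ N₀ : ℕ, ∀ N : ℕ, N₀ ≤ N →
          ∃ μ : Measure H3, IsWitness f ν N E ε μ :=
  Iff.rfl

/-! ## §1 Bernstein ceiling at level `N` (no stationarity used) -/

/-- Frequencies off the punctured ball: either `k = 0` or `N² < |k|²`. -/
theorem not_mem_erase_freqBall_of_lt {N : ℕ} {k : Fin 3 → ℤ} (hk : ((N : ℝ)) ^ 2 < Torus.freqNormSq k) :
    k ∉ (Torus.freqBall N).erase (0 : Fin 3 → ℤ) := by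
  intro h
  have h2 := (Finset.mem_erase.1 h).2
  rw [Torus.mem_freqBall] at h2
  exact absurd h2 (not_le.2 hk)

/-- BERNSTEIN on `H`: a level-`N` field has `‖∇u‖₂² ≤ 4π²N²‖u‖²` (spectral gradient norm of its
`L²` representative). -/
theorem eGradNormSq_le_of_isLevel {N : ℕ} {u : H3} (hu : IsLevel N u) :
    Torus.eGradNormSq ((u : L2T3) : T3 → R3) ≤
      ENNReal.ofReal (4 * Real.pi ^ 2 * (N : ℝ) ^ 2 * ‖u‖ ^ 2) := by
  set v : T3 → R3 := ((u : L2T3) : T3 → R3) with hv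
  have hmem : MemLp v 2 volume := Lp.memLp (u : L2T3)
  set gC : T3 → EuclideanSpace ℂ (Fin 3) := EuclideanSpace.complexify ∘ v with hgC
  have hpar := Torus.hasSum_sq_norm_mFourierCoeff_complexify hmem
  have hband : ∀ k : Fin 3 → ℤ, ((N : ℝ)) ^ 2 < Torus.freqNormSq k → mFourierCoeff gC k = 0 :=
    fun k hk => hu k (not_mem_erase_freqBall_of_lt hk)
  have hterm : ∀ k : Fin 3 → ℤ,
      (if k = 0 then 0 else ENNReal.ofReal (Torus.freqNormSq k ^ (1 : ℝ))) * ‖mFourierCoeff gC k‖ₑ ^ 2 ≤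
        ENNReal.ofReal ((N : ℝ) ^ 2) * ‖mFourierCoeff gC k‖ₑ ^ 2 := by
    intro k
    split_ifs with hk
    · simp
    · by_cases hb : ((N : ℝ)) ^ 2 < Torus.freqNormSq k
      · rw [hband k hb]; simp
      · rw [Real.rpow_one]
        gcongr
        exact not_lt.1 hb
  have hsum : Torus.eHomSobolevSeminorm 1 gC ^ 2 ≤
      ENNReal.ofReal ((N : ℝ) ^ 2) * ∑' k, ‖mFourierCoeff gC k‖ₑ ^ 2 := by
    rw [Torus.eHomSobolevSeminorm, ENNReal.rpow_half_sq, ← ENNReal.tsum_mul_left]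
    exact ENNReal.tsum_le_tsum hterm
  have htsum : ∑' k, ‖mFourierCoeff gC k‖ₑ ^ 2 = ENNReal.ofReal (∫ x, ‖v x‖ ^ 2) := by
    have h1 : ∀ k, ‖mFourierCoeff gC k‖ₑ ^ 2 = ENNReal.ofReal (‖mFourierCoeff gC k‖ ^ 2) := fun k => by
      rw [← ofReal_norm, ENNReal.ofReal_pow (norm_nonneg _)]
    simp_rw [h1]
    rw [← ENNReal.ofReal_tsum_of_nonneg (fun k => sq_nonneg _) hpar.summable, hpar.tsum_eq]
  have hI : ∫ x, ‖v x‖ ^ 2 = ‖u‖ ^ 2 := by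
    rw [hv, Torus.integral_norm_sq_coe_eq]; rfl
  rw [Torus.eGradNormSq]
  calc ENNReal.ofReal (4 * Real.pi ^ 2) * Torus.eHomSobolevSeminorm 1 (EuclideanSpace.complexify ∘ v) ^ 2
      ≤ ENNReal.ofReal (4 * Real.pi ^ 2) * (ENNReal.ofReal ((N : ℝ) ^ 2) * ∑' k, ‖mFourierCoeff gC k‖ₑ ^ 2) := by
        gcongr
    _ = ENNReal.ofReal (4 * Real.pi ^ 2 * (N : ℝ) ^ 2 * ‖u‖ ^ 2) := by
        rw [htsum, hI, ← ENNReal.ofReal_mul (by positivity), ← ENNReal.ofReal_mul (by positivity)]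
        congr 1
        ring

/-- LEVEL-`N` DISSIPATION CEILING: for a law carried by level-`N` fields with integrable energy,
`ensembleDissipation ν μ ≤ 4π²N²ν · ensembleEnergy μ` (`ν ≥ 0`). No stationarity is used. -/
theorem ensembleDissipation_le_of_isLevel {N : ℕ} {μ : Measure H3}
    (hlev : ∀ᵐ u ∂μ, IsLevel N u) (hint : Integrable (fun u : H3 => ‖u‖ ^ 2) μ) {ν : ℝ} (hν : 0 ≤ ν) :
    Torus.ensembleDissipation ν μ ≤ 4 * Real.pi ^ 2 * (N : ℝ) ^ 2 * ν * Torus.ensembleEnergy μ := by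
  set c : ℝ := 4 * Real.pi ^ 2 * (N : ℝ) ^ 2 with hc
  have hc0 : 0 ≤ c := by positivity
  have h1 : ∫⁻ u, Torus.eGradNormSq ((u : L2T3) : T3 → R3) ∂μ ≤
      ∫⁻ u, ENNReal.ofReal (c * ‖u‖ ^ 2) ∂μ :=
    lintegral_mono_ae (hlev.mono fun u hu => by
      have := eGradNormSq_le_of_isLevel hu
      rwa [hc])
  have h2 : ∫⁻ u, ENNReal.ofReal (c * ‖u‖ ^ 2) ∂μ = ENNReal.ofReal (∫ u, c * ‖u‖ ^ 2 ∂μ) :=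
    (ofReal_integral_eq_lintegral_ofReal (hint.const_mul c)
      (ae_of_all _ fun u => by positivity)).symm
  have h3 : (∫⁻ u, Torus.eGradNormSq ((u : L2T3) : T3 → R3) ∂μ).toReal ≤ c * ∫ u, ‖u‖ ^ 2 ∂μ := by
    have := ENNReal.toReal_mono ENNReal.ofReal_ne_top (h1.trans_eq h2)
    rwa [ENNReal.toReal_ofReal (by
      rw [integral_const_mul]; exact mul_nonneg hc0 (integral_nonneg fun _ => by positivity)),
      integral_const_mul] at this
  unfold Torus.ensembleDissipation Torus.ensembleEnstrophy Torus.ensembleEnergy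
  calc ν * (∫⁻ u, Torus.eGradNormSq ((u : L2T3) : T3 → R3) ∂μ).toReal
      ≤ ν * (c * ∫ u, ‖u‖ ^ 2 ∂μ) := mul_le_mul_of_nonneg_left h3 hν
    _ = c * ν * ∫ u, ‖u‖ ^ 2 ∂μ := by ring


/-! ## §3 Concrete forces: the zero force, a constant wind force, a gradient mode, a shear mode -/

section Forces

/-- The first lattice direction `e₁ = (1,0,0) ∈ ℤ³`. -/
def k₁ : Fin 3 → ℤ := Pi.single 0 1

/-- `e₁ ≠ 0`. -/
theorem k₁_ne_zero : k₁ ≠ 0 := by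
  intro h
  have := congrFun h 0
  simp [k₁] at this

/-- `k ≠ 0 ⇒ k ≠ -k` in `ℤ³`. -/
theorem ne_neg_self_of_ne_zero {k : Fin 3 → ℤ} (hk : k ≠ 0) : k ≠ -k := by
  intro h
  apply hk
  funext i
  have := congrFun h i
  simp only [Pi.neg_apply] at this
  change k i = 0
  omega

/-- Fourier coefficients of the zero field vanish. -/
theorem mFourierCoeff_zero_field (k : Fin 3 → ℤ) :
    mFourierCoeff (EuclideanSpace.complexify ∘ (0 : T3 → R3)) k = 0 := by
  rw [Torus.mFourierCoeff_eq_integral_volume]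
  simp

/-- A single real mode with non-zero frequency and amplitude is a non-zero field. -/
theorem realTrigPoly_singleton_ne_zero {k : Fin 3 → ℤ} (hk : k ≠ 0) {z : EuclideanSpace ℂ (Fin 3)}
    (hz : z ≠ 0) : Torus.realTrigPoly {k} (fun _ => z) ≠ 0 := by
  intro h
  have hc := Torus.mFourierCoeff_realTrigPoly_singleton k (fun _ => z) k
  rw [h, mFourierCoeff_zero_field, if_pos rfl, if_neg (ne_neg_self_of_ne_zero hk),
    EuclideanSpace.conjVec_zero, add_zero] at hc
  have : z = 0 := by
    have h2 : (2 : ℂ)⁻¹ • z = 0 := hc.symm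
    rcases smul_eq_zero.1 h2 with h3 | h3
    · exact absurd h3 (by norm_num)
    · exact h3
  exact hz this

/-- A single real mode with non-zero frequency has zero mean. -/
theorem hasZeroMean_realTrigPoly_singleton {k : Fin 3 → ℤ} (hk : k ≠ 0) (z : EuclideanSpace ℂ (Fin 3)) :
    Torus.HasZeroMean (Torus.realTrigPoly {k} (fun _ => z)) := by
  rw [Torus.HasZeroMean]
  simp_rw [Torus.realTrigPoly_singleton_apply]
  have hi : Integrable (fun x : T3 => mFourier k x • z) volume :=
    ((mFourier k).continuous.smul continuous_const).integrable_unitAddTorus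
  rw [ContinuousLinearMap.integral_comp_comm _ hi, integral_smul_const, Torus.integral_mFourier,
    if_neg hk, zero_smul, map_zero]

/-- **Gradient force**: the longitudinal mode `cos(2πx₁) e₁ = Re (e_{e₁} • e₁)` (a pressure gradient). -/
def gradForce : T3 → R3 := Torus.realTrigPoly {k₁} (fun _ => EuclideanSpace.complexify (Torus.latticeVec k₁))

/-- The gradient force is smooth. -/
theorem isSmooth_gradForce : Torus.IsSmooth gradForce := Torus.isSmooth_realTrigPoly _ _

/-- The gradient force has zero mean. -/
theorem hasZeroMean_gradForce : Torus.HasZeroMean gradForce := hasZeroMean_realTrigPoly_singleton k₁_ne_zero _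

/-- The gradient force is non-zero. -/
theorem gradForce_ne_zero : gradForce ≠ 0 := by
  refine realTrigPoly_singleton_ne_zero k₁_ne_zero fun h => ?_
  have := congrArg (fun v : EuclideanSpace ℂ (Fin 3) => v 0) h
  simp [Torus.latticeVec_apply, k₁] at this

/-- A gradient force does no work on `H`: `(u, ∇φ) = 0` (here: the longitudinal mode is
`L²`-orthogonal to every weakly divergence-free field, by transversality of `û`). -/
theorem pairing_gradForce (u : H3) : Torus.pairing u.1 gradForce = 0 := by
  have hmem : MemLp ((u : L2T3) : T3 → R3) 2 volume := Lp.memLp (u : L2T3)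
  have hint : Integrable ((u : L2T3) : T3 → R3) volume := hmem.integrable one_le_two
  have hdiv := Torus.isWeaklyDivFree_of_mem_energySpace u.2
  have htr := hdiv.sum_mul_mFourierCoeff_eq_zero hmem k₁
  rw [Torus.pairing, gradForce, Torus.integral_inner_realTrigPoly_singleton hint,
    Torus.re_inner_complexify_eq_sum]
  simp_rw [Torus.latticeVec_apply]
  have := congrArg Complex.re htr
  rw [Complex.re_sum] at this
  simp only [Complex.mul_re, Complex.intCast_re, Complex.intCast_im, zero_mul, sub_zero,
    Complex.zero_re] at this
  rw [← this]
  exact Finset.sum_congr rfl fun i _ => by ring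

/-- **Wind force**: the constant field `e₁` (not mean-zero). -/
def windForce : T3 → R3 := fun _ => EuclideanSpace.single 0 1

/-- The wind force is smooth. -/
theorem isSmooth_windForce : Torus.IsSmooth windForce := Torus.isSmooth_const _

/-- Constant fields are divergence free. -/
theorem isDivFree_const (a : R3) : Torus.IsDivFree (fun _ : T3 => a) := by
  intro x
  simp [Torus.divergence, Torus.partialDeriv, Torus.lineDeriv]

/-- The wind force is divergence free. -/
theorem isDivFree_windForce : Torus.IsDivFree windForce := isDivFree_const _

/-- The wind force is non-zero. -/
theorem windForce_ne_zero : windForce ≠ 0 := by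
  intro h
  have := congrArg (fun v : R3 => v 0) (congrFun h (0 : T3))
  simp [windForce] at this

/-- A constant force does no work on `H`: `(u, a) = ⟪∫u, a⟫ = 0` (mean-zero fields). -/
theorem pairing_const (u : H3) (a : R3) : Torus.pairing u.1 (fun _ => a) = 0 := by
  have hint : Integrable ((u : L2T3) : T3 → R3) volume := (Lp.memLp (u : L2T3)).integrable one_le_two
  rw [Torus.pairing]
  simp_rw [real_inner_comm a]
  rw [integral_inner hint a, Torus.integral_eq_zero_of_mem_energySpace u.2, inner_zero_right]

/-- The zero force. -/
theorem isSmooth_zeroForce : Torus.IsSmooth (0 : T3 → R3) := Torus.isSmooth_const (0 : R3)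

/-- The zero force is divergence free. -/
theorem isDivFree_zeroForce : Torus.IsDivFree (0 : T3 → R3) := isDivFree_const (0 : R3)

/-- The zero force has zero mean. -/
theorem hasZeroMean_zeroForce : Torus.HasZeroMean (0 : T3 → R3) := by
  simp [Torus.HasZeroMean]

/-- The zero force does no work. -/
theorem pairing_zeroForce (u : H3) : Torus.pairing u.1 (0 : T3 → R3) = 0 := by
  simp [Torus.pairing]

/-- **Shear (Kolmogorov) force**: `cos(2πx₁) e₂`, the frame field of frequency `e₁`, direction `e₂`. -/
def shearForce : T3 → R3 := Torus.frameField k₁ 1 true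

/-- The shear force is smooth. -/
theorem isSmooth_shearForce : Torus.IsSmooth shearForce := Torus.isSmooth_realTrigPoly _ _

/-- The shear force is divergence free. -/
theorem isDivFree_shearForce : Torus.IsDivFree shearForce := Torus.isDivFree_frameField k₁_ne_zero _ _

/-- The shear force has zero mean. -/
theorem hasZeroMean_shearForce : Torus.HasZeroMean shearForce := Torus.integral_frameField k₁_ne_zero _ _

/-- The shear force is non-zero. -/
theorem shearForce_ne_zero : shearForce ≠ 0 := by
  refine realTrigPoly_singleton_ne_zero k₁_ne_zero fun h => ?_
  have := congrArg (fun v : EuclideanSpace ℂ (Fin 3) => v 1) h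
  simp [Torus.frameVec, Torus.perpVec_apply, k₁] at this

/-- Smooth forces are `L²`. -/
theorem memLp_of_isSmooth {f : T3 → R3} (hf : Torus.IsSmooth f) : MemLp f 2 volume := hf.memLp 2

end Forces

end Summit.AnomalousDissipation.AnomalousDissipation.Theorems.CubicParityLoud.Negative
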